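import Summits.QuantumFields.BalabanUV.T4Continuum.Support.ShellMeasureRootCompositionSeam
import Summits.QuantumFields.BalabanUV.T4Continuum.Support.ShellMeasureWilsonGaugeInvariant
import Summits.QuantumFields.BalabanUV.T4Continuum.Support.ShellMeasureWindowLiaison

/-!
# `T4Continuum.Spine.NE7c.LeafIndex` — NE7c formalisation swarm: the TYPER's LEAF INDEX and the GENERIC JUNCTION
# «per-slot (M1) with SLOT constants + LEVEL-ONLY majorants ⇒ END-I» for ANY finite slot-measure family
# (kernel bookkeeping, no estimate)
# (cell `pub-balaban`, sub-cell `t4`, spine estimate NE7c (node U5b); typer seat `b2b-balaban-t4-ne7c-formalise-typer`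
# of the swarm `t4-ne7c-formalise-*` under `t4/T4-NE7c-TRIGGER.json` conditions c1–c6; companion files
# `t4/formal/NE7c/DAG.md` (nodes = lemmas with Lean statements, edges = uses) and `t4/formal/NE7c/LEAVES.md`;
# ADDITIVE — imports the SEAM `ShellMeasureRootCompositionSeam` (p208381; itself importing END-I
# `ShellMeasureRootComposition` p207618 and END-II `ShellMeasureRootCompositionSU2` p207698), the level-0 face
# `ShellMeasureWilsonGaugeInvariant` (p207446) and the liaison `ShellMeasureWindowLiaison` (p207645), so that this ONE
# module is an import apex of the node's composition spine; 0 `def`, 0 sorry; v2 — v1's `hac_of_slotwise` is the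
# seam's `hac_of_slotConst` and is cited BY NAME, not restated)

HONEST FRAMING.  Finite four-torus programme, rung (B)+1 only — NOT infinite volume, NOT a mass gap, NOT the Clay
problem, NOT summit progress.  NE7c = `T4IndicatorShell.ShellWeightBound` is NOT PRINTED in [Balaban 1983–89] and
NOT PROVED: the node's theorems are the COMPOSITION «NE7c ⇐ the named binders» (trigger c3) and assert none of
them.  No `def … : Prop` is minted here for SM-L1 / SM-L4 / SM-L6 / SM-L7 (trigger c2): they stay DISPLAYED BINDERS of
END-I / END-II; nothing printed is cited; (M1)₀ realized ≠ NE7c.  Spine PROVED 0/9.  HONEST DEPENDENCY: continuum YM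
on T⁴ ⇐ BetaPertH ∧ nine spine estimates (0/9 proved); BetaPertH ⇐ (D1) ∧ (D4) ∧ CAP+tail; G-an2-4 gates asym, D1
and NE2/3/4.

## §0 LEAF INDEX (DAG node ↦ tree declaration ↦ gate id; `Lit.` = `Literature.MathematicalPhysics.QuantumFieldTheory.
## Balaban1983to89`, `Sup.` = `Summit.QuantumFields.BalabanUV.T4Continuum`; rows = the owner's claim table
## `t4/b2b-balaban-t4-ne7c-p1/LEAVES-NE7c-P1.md`)
* R0 TARGET   `Lit.T4IndicatorShell.ShellWeightBound l₀ T A B shA shB Wsh` (structure, 9 fields) — consumed by the seam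
  (ζ′) `Lit.T4MatchingClosureSocket.hybridNE7_closure'_tail` / `Lit.T4ShellMeasureLevels.hybridNE7_tail_of_levels`.
* L1  `Lit.T4ShellMeasureLevels.shellWeightBound_of_levels` (two `LevelLedger`s + `LiveWindow`s + `D ≤ D̄` + rate ⇒ R0);
  L1b `Sup.ShellMeasureBandCount.shellWeightBound_of_levels_band` (road P2 twin: `Summable ρ` + age counts).
* L2  `Lit.T4ShellMeasure.SlotAntiConcentration μ u θ ρ D` — (M1), THE WALL, a parametric HYPOTHESIS SHAPE — and
  `Lit.T4ShellMeasure.slot_field_of_antiConcentration` ((M1) + [dict] push ⇒ `LevelLedger.slot`).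
* L3  `Sup.ShellMeasureScalingLocal.slotAntiConcentration_of_coreMap_mul` (the one-depth engine on a chart);
  A3  `Sup.ShellMeasureLevelAssembly.slotAntiConcentration_of_levelData` (+ `classifierWitness_of_bondData`,
  `good_moving_of_bondData`) — chart-level (M1) ⇐ SM-L1 `hAN`, SM-L2 `hSM`, SM-L3 `hGW`, SM-L4 `hE`, SM-L5/6 `hJW`/`hJ`.
* TR  transports: `Lit.T4ShellMeasureFibre.slotAntiConcentration_mono` / `…_of_dominated`,
  `Lit.T4ShellMeasureDet.slotAntiConcentration_realized_of_sections` / `…_of_chart`, `Sup.ShellMeasureScalingSU2.chart_su2`,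
  `Sup.ShellMeasureScalingLocal.slotAntiConcentration_gaugeFixed_iff`.
* E1  (row S7a, p207618) END-I `Sup.ShellMeasureRootComposition.shellWeightBound_of_slotAC` (+ `levelLedger_of_slotAC`,
  `_band`, `hybridNE7_tail_of_slotAC`): per run (R) `sh_nonneg/sh_le/cover`, [dict] `hM/piece_le/total_ge`, THE WALL
  `hac` = (M1) per slot BY LEVEL; then (W1) `hwA/hwB`, `0 < ϑ < 1`, `D ≤ D̄`, rate `ρ_j ≤ c₁ϑ^j` (node U1b BY NAME, c4) ⇒ R0.
* E2  (row S7b, p207698) END-II `Sup.ShellMeasureRootCompositionSU2.slotAC_realized_su2_of_levelData`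
  (+ `…_of_chartAC(_gauge)`): realized (M1) for `(fieldMeasure P j SU2).withDensity F` ⇐ per tree-gauged exterior
  section the DICTIONARY `hRdict/hudict` and SM-L1…L6, with the SLOT's constant `2(n + β Σ_{p∈Pw} lw(dw + 4sw) + B𝓔)/(1 − δ)`.
  Typer diagnostic T-NE7c-4 (= F-ne7cleaf09-1, ruled by the row owner): the dictionary binders are asked for all chart
  points but consumed on the chart cube only; the re-typed form with `∀ x ∈ cube n S` guards is row S11's
  `Sup.ShellMeasureRootCompositionLevelZero.slotAC_realized_su2_of_levelData_cube` (in flight), to which the consumers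
  below re-wire when it lands.
* A   (row S13, p208381) THE SEAM `Sup.ShellMeasureRootCompositionSeam.shellWeightBound_of_levelDataSU2` (+ `_band`,
  `hybridNE7_tail_of_levelDataSU2`, `levelLedger_of_levelDataSU2`): END-I for the REALIZED `SU(2)` slot families
  `(fieldMeasure P (lvl K s) SU2).withDensity (F K t s)` from per-slot (M1) with SLOT constants, `∫⁻ F ∂fieldMeasure ≠ ∞`
  per slot and displayed majorants `Dslot K t s ≤ D (lvl K s)`; atoms `hac_of_slotConst` (ANY slot family — used in
  §1/§2 below), `hac_of_levelData`, `slotAC_realized_su2_of_levelData_le` (E2 + one displayed level majorant).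
* S4  (p208247) `Sup.ShellMeasureBlockWiring.hAN_of_blockBondData` / `hGW_of_blockBondData` /
  `slotAC_realized_su2_of_blockBondData`: E2's `hAN`/`hGW` from PER-BOND analytic data `(X, a_b)` + frozen exterior
  letters, `H = e^{4a} − 1`; S14 (p208432) `Sup.ShellMeasureMinimiserBonds.classifierWitness_of_prop6Scheme`: the per-bond
  data, hence the `hAN` witness, from B11 Prop. 6's contraction scheme `Lit.B11Prop6Scheme.solution_analytic` + flat
  centre + CLM read-outs (SM-L1 RE-SOURCED to displayed B11-type binders; NOT an instance).
* Z0  (row S1, p207446) level-0 face `Sup.ShellMeasureWilsonGaugeInvariant.slotAntiConcentration_wilson_su2_gaugeInvariant`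
  (`Sup.ShellMeasureWilsonRealizedSU2.slotAntiConcentration_wilson_su2`, `Sup.ShellMeasureWilsonBlock.slotAntiConcentration_levelZero`):
  (M1)₀ for SU(2), NO analytic binder, constant `2(n + β·#Pw·8S(8 + 32S))/(1 − δ)`; S2 (p208215)
  `Sup.ShellMeasureWilsonStraddle.slotAntiConcentration_wilson_su2_coTests(_two)`: the same with straddling co-tests
  dropped against a DISPLAYED mass ratio `M` ((MR)₀), constant `·M`.
* W   (row S9, p207645) liaison `Sup.ShellMeasureWindowLiaison.liveWindow_of_torusCount` (E1 `hwX`), `rate_geomWidth`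
  (E1 `hrateX` in node U1b's shape; NO rate proved), `lintegral_mismatch_le(_of_slotAC)` / `integral_mismatch_le`
  (E1 `piece_leX`); S12 (p208279) `Sup.ShellMeasureRootCompositionPush.levelLedger_levelZero`: E1's per-run (R)+[dict]
  binders PROVED for one level-0 slot (`M = 1`), only (M1)₀ displayed; S10 (p207982)
  `Sup.ShellMeasureRootCompositionToy.toy_shellWeightBound`: END-I fires on non-degenerate toy data.
* Crew rows in flight (targets and acceptance tests in `t4/formal/NE7c/{DAG,LEAVES}.md`): S11
  `ShellMeasureRootCompositionLevelZero` (E2 re-typed on the cube and specialised to level 0), S15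
  `ShellMeasureWindowInsertion` (E2's window binder from box-plaquette co-tests at any level), S16 `ShellMeasureRayWiring`
  (E2's `hE` from per-term analytic pairs), S3 `ShellMeasureExpChartSUN`/`ShellMeasureScalingSUN` (SU(N) chart, last, c5).

## §1–§2 THE GENERIC JUNCTION (typer diagnostic T-NE7c-1, kernel)
END-I's wall binder `hacX` is indexed by `(K, t, s)` with threshold / width / constant `θ (lvl K s)`, `ρ (lvl K s)`,
`D (lvl K s)` — functions of the LEVEL only — for every source `|t| ≤ l₀`; END-II and the level-0 face deliver (M1) per
slot with a constant in the SLOT's own chart data.  The seam (row S13) closes this for the realized `SU(2)` family; §1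
`levelLedger_of_slotwiseAC` and §2 `shellWeightBound_of_slotwiseAC` below are the same junction for an ARBITRARY family of
finite slot measures `μ K t s` on arbitrary measurable spaces (the socket for a non-`SU(2)` realized assembly — the
`SU(N)` chart of row S3, or an abstract second member), through the seam's atom
`ShellMeasureRootCompositionSeam.hac_of_slotConst` BY NAME.  CONCLUSIONS: `LevelLedger …` / LITERALLY
`T4IndicatorShell.ShellWeightBound l₀ T A B shA shB Wsh` with END-I's `Wsh`.

WHAT THIS DOES NOT DO.  No binder is discharged; no estimate, no rate, no citation; NE7c NOT proved; 0/9 spine.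
-/

open Finset MeasureTheory

namespace Summit.QuantumFields.BalabanUV.T4Continuum.Spine.NE7c.LeafIndex

open Literature.MathematicalPhysics.QuantumFieldTheory.Balaban1983to89
open T4IndicatorShell T4ShellMeasure
open T4ShellMeasureLevels (LevelLedger LiveWindow)
open T4ShellMeasureFibre (slotAntiConcentration_mono)
open ShellMeasureRootComposition (levelLedger_of_slotAC shellWeightBound_of_slotAC)
open ShellMeasureRootCompositionSeam (hac_of_slotConst)

/-! ## §1 One run: the level ledger from slot data + (M1) per slot with SLOT constants (any finite family) -/

section OneRun

variable {ι σ : Type*} {Ω : ℕ → σ → Type*} [∀ K s, MeasurableSpace (Ω K s)]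
  {l₀ : ℝ} {T : ℕ → Finset ι} {A sh : ℕ → ℝ → ι → ℝ} {S : ℕ → Finset σ} {piece : ℕ → ℝ → σ → ι → ℝ}
  {lvl : ℕ → σ → ℕ} {μ : ∀ K : ℕ, ℝ → ∀ s : σ, Measure (Ω K s)}
  {u : ∀ K : ℕ, ℝ → ∀ s : σ, Ω K s → ℝ} {θ D ρ : ℕ → ℝ} {M Dslot : ℕ → ℝ → σ → ℝ}

variable [∀ K t s, IsFiniteMeasure (μ K t s)]

/-- **ONE RUN'S LEVEL LEDGER FROM SLOT DATA + (M1) PER SLOT WITH SLOT CONSTANTS.**  The binders of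
`ShellMeasureRootComposition.levelLedger_of_slotAC` ((R) `sh_nonneg/sh_le/cover`, [dict] `hM/piece_le/total_ge`,
`0 ≤ D_j`, `0 ≤ ρ_j`) with the wall stated per slot (`hacS`, constant `Dslot K t s`) and the majorant `hmaj`;
conclusion `LevelLedger l₀ T A sh S piece lvl D ρ`; the slot→level step is the seam's `hac_of_slotConst`. [folklore] -/
theorem levelLedger_of_slotwiseAC
    (sh_nonneg : ∀ K t, |t| ≤ l₀ → ∀ τ ∈ T K, 0 ≤ sh K t τ)
    (sh_le : ∀ K t, |t| ≤ l₀ → ∀ τ ∈ T K, sh K t τ ≤ A K t τ)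
    (cover : ∀ K t, |t| ≤ l₀ → ∀ τ ∈ T K, sh K t τ ≤ ∑ s ∈ S K, piece K t s τ)
    (hM : ∀ K t, |t| ≤ l₀ → ∀ s ∈ S K, 0 ≤ M K t s)
    (piece_le : ∀ K t, |t| ≤ l₀ → ∀ s ∈ S K, ∑ τ ∈ T K, piece K t s τ ≤ M K t s *
      (μ K t s {x | θ (lvl K s) * (1 - ρ (lvl K s)) ≤ u K t s x ∧ u K t s x < θ (lvl K s)}).toReal)
    (total_ge : ∀ K t, |t| ≤ l₀ → ∀ s ∈ S K, M K t s * (μ K t s Set.univ).toReal ≤ ∑ τ ∈ T K, A K t τ)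
    (hD : ∀ j, 0 ≤ D j) (hρ : ∀ j, 0 ≤ ρ j)
    (hacS : ∀ K t, |t| ≤ l₀ → ∀ s ∈ S K,
      SlotAntiConcentration (μ K t s) (u K t s) (θ (lvl K s)) (ρ (lvl K s)) (Dslot K t s))
    (hmaj : ∀ K t, |t| ≤ l₀ → ∀ s ∈ S K, Dslot K t s ≤ D (lvl K s)) :
    LevelLedger l₀ T A sh S piece lvl D ρ :=
  levelLedger_of_slotAC sh_nonneg sh_le cover hM piece_le total_ge hD hρ (hac_of_slotConst hρ hmaj hacS)

end OneRun

/-! ## §2 Two runs: END-I with the wall per slot, generic family (the socket of a non-`SU(2)` realized assembly) -/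

section TwoRuns

variable {ι σ σ' : Type*} {ΩA : ℕ → σ → Type*} {ΩB : ℕ → σ' → Type*} [∀ K s, MeasurableSpace (ΩA K s)]
  [∀ K s, MeasurableSpace (ΩB K s)] {l₀ : ℝ} {T : ℕ → Finset ι} {A B shA shB : ℕ → ℝ → ι → ℝ}
  {SA : ℕ → Finset σ} {SB : ℕ → Finset σ'} {pieceA : ℕ → ℝ → σ → ι → ℝ} {pieceB : ℕ → ℝ → σ' → ι → ℝ}
  {lvlA : ℕ → σ → ℕ} {lvlB : ℕ → σ' → ℕ}
  {μA : ∀ K : ℕ, ℝ → ∀ s : σ, Measure (ΩA K s)} [∀ K t s, IsFiniteMeasure (μA K t s)]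
  {μB : ∀ K : ℕ, ℝ → ∀ s : σ', Measure (ΩB K s)} [∀ K t s, IsFiniteMeasure (μB K t s)]
  {uA : ∀ K : ℕ, ℝ → ∀ s : σ, ΩA K s → ℝ} {uB : ∀ K : ℕ, ℝ → ∀ s : σ', ΩB K s → ℝ}
  {θA DA ρA θB DB ρB : ℕ → ℝ} {MA DslotA : ℕ → ℝ → σ → ℝ} {MB DslotB : ℕ → ℝ → σ' → ℝ}
  {N₁ : ℕ} {νbar Dbar c₁ ϑ : ℝ}

/-- **END-I WITH THE WALL PER SLOT — `ShellWeightBound` ⇐ THE NAMED BINDERS (trigger c3).**  Exactly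
`ShellMeasureRootComposition.shellWeightBound_of_slotAC` (END-I, p207618) except that each run's wall is displayed PER
SLOT with the slot's own constant (`hacSA`/`hacSB`) together with the LEVEL-ONLY majorants `hmajA`/`hmajB` (K-uniform
block geometry) — for an ARBITRARY family of finite slot measures (the realized `SU(2)` instance is the seam's
`ShellMeasureRootCompositionSeam.shellWeightBound_of_levelDataSU2`, row S13).  CONCLUSION: LITERALLY
`T4IndicatorShell.ShellWeightBound l₀ T A B shA shB Wsh`, `Wsh K = Σ_{s∈S^A K} D^A_{lvl s} ρ^A_{lvl s} + Σ_{s∈S^B K}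
D^B_{lvl s} ρ^B_{lvl s}`.  CONDITIONAL on every binder; no estimate, no rate (node U1b BY NAME, c4), nothing PRINTED
asserted; NE7c NOT proved. [folklore] -/
theorem shellWeightBound_of_slotwiseAC
    -- run A: (R), [dict] push, (M1) per slot with slot constants, level majorant
    (sh_nonnegA : ∀ K t, |t| ≤ l₀ → ∀ τ ∈ T K, 0 ≤ shA K t τ)
    (sh_leA : ∀ K t, |t| ≤ l₀ → ∀ τ ∈ T K, shA K t τ ≤ A K t τ)
    (coverA : ∀ K t, |t| ≤ l₀ → ∀ τ ∈ T K, shA K t τ ≤ ∑ s ∈ SA K, pieceA K t s τ)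
    (hMA : ∀ K t, |t| ≤ l₀ → ∀ s ∈ SA K, 0 ≤ MA K t s)
    (piece_leA : ∀ K t, |t| ≤ l₀ → ∀ s ∈ SA K, ∑ τ ∈ T K, pieceA K t s τ ≤ MA K t s *
      (μA K t s {x | θA (lvlA K s) * (1 - ρA (lvlA K s)) ≤ uA K t s x ∧ uA K t s x < θA (lvlA K s)}).toReal)
    (total_geA : ∀ K t, |t| ≤ l₀ → ∀ s ∈ SA K, MA K t s * (μA K t s Set.univ).toReal ≤ ∑ τ ∈ T K, A K t τ)
    (hDA0 : ∀ j, 0 ≤ DA j) (hρA0 : ∀ j, 0 ≤ ρA j)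
    (hacSA : ∀ K t, |t| ≤ l₀ → ∀ s ∈ SA K,
      SlotAntiConcentration (μA K t s) (uA K t s) (θA (lvlA K s)) (ρA (lvlA K s)) (DslotA K t s))
    (hmajA : ∀ K t, |t| ≤ l₀ → ∀ s ∈ SA K, DslotA K t s ≤ DA (lvlA K s))
    -- run B: the same
    (sh_nonnegB : ∀ K t, |t| ≤ l₀ → ∀ τ ∈ T K, 0 ≤ shB K t τ)
    (sh_leB : ∀ K t, |t| ≤ l₀ → ∀ τ ∈ T K, shB K t τ ≤ B K t τ)
    (coverB : ∀ K t, |t| ≤ l₀ → ∀ τ ∈ T K, shB K t τ ≤ ∑ s ∈ SB K, pieceB K t s τ)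
    (hMB : ∀ K t, |t| ≤ l₀ → ∀ s ∈ SB K, 0 ≤ MB K t s)
    (piece_leB : ∀ K t, |t| ≤ l₀ → ∀ s ∈ SB K, ∑ τ ∈ T K, pieceB K t s τ ≤ MB K t s *
      (μB K t s {x | θB (lvlB K s) * (1 - ρB (lvlB K s)) ≤ uB K t s x ∧ uB K t s x < θB (lvlB K s)}).toReal)
    (total_geB : ∀ K t, |t| ≤ l₀ → ∀ s ∈ SB K, MB K t s * (μB K t s Set.univ).toReal ≤ ∑ τ ∈ T K, B K t τ)
    (hDB0 : ∀ j, 0 ≤ DB j) (hρB0 : ∀ j, 0 ≤ ρB j)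
    (hacSB : ∀ K t, |t| ≤ l₀ → ∀ s ∈ SB K,
      SlotAntiConcentration (μB K t s) (uB K t s) (θB (lvlB K s)) (ρB (lvlB K s)) (DslotB K t s))
    (hmajB : ∀ K t, |t| ≤ l₀ → ∀ s ∈ SB K, DslotB K t s ≤ DB (lvlB K s))
    -- (W1) windows + count, constant bound, rate (node U1b BY NAME)
    (hwA : LiveWindow SA lvlA N₁ νbar) (hwB : LiveWindow SB lvlB N₁ νbar) (hϑ0 : 0 < ϑ) (hϑ1 : ϑ < 1)
    (hDA : ∀ j, DA j ≤ Dbar) (hDB : ∀ j, DB j ≤ Dbar)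
    (hrateA : ∀ j, ρA j ≤ c₁ * ϑ ^ j) (hrateB : ∀ j, ρB j ≤ c₁ * ϑ ^ j) :
    ShellWeightBound l₀ T A B shA shB
      (fun K => ∑ s ∈ SA K, DA (lvlA K s) * ρA (lvlA K s) + ∑ s ∈ SB K, DB (lvlB K s) * ρB (lvlB K s)) :=
  shellWeightBound_of_slotAC sh_nonnegA sh_leA coverA hMA piece_leA total_geA hDA0 hρA0
    (hac_of_slotConst hρA0 hmajA hacSA)
    sh_nonnegB sh_leB coverB hMB piece_leB total_geB hDB0 hρB0 (hac_of_slotConst hρB0 hmajB hacSB)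
    hwA hwB hϑ0 hϑ1 hDA hDB hrateA hrateB

end TwoRuns

end Summit.QuantumFields.BalabanUV.T4Continuum.Spine.NE7c.LeafIndex
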